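import Summits.NavierStokesRegularity.FunctionalMining.NoGo.HalfShiftWirtingerEngine
import HarnessLib

/-!
# FunctionalMining / NoGo — HALF-SHIFT WIRTINGER TOOLS, file 2 of 2: the antipodal zero and the
# constrained Wirtinger inequality for EVERY exponent (door (c), node K6, Lemma L-λ(q))

search for candidate a priori estimates; no regularity claim. Cell `pub-nsfunc` (NS FUNCTIONAL MINING), nogo seat
(gen 50), tool file of the K40 line (see file 1, `NoGo/HalfShiftWirtingerEngine`, for the WHY). Elementary real
analysis on an interval; nothing about Navier–Stokes dynamics; no node of the cell is decided here.

THIS FILE (all on a period `[a, b]`, `T = b − a`, or on `[−1, 1]`):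
* `periodic_wirtinger_of_zero` — `E a = E b` and `E` vanishes somewhere ⇒ `(π/T)²∫ₐᵇE² ≤ ∫ₐᵇE′²` (the engine of
  file 1 with the period rotated to start at the zero);
* `wirtinger_of_antipodal_zero` — `u(−1) = u(1)` and `u(y₀) + u(y₀ + 1) = 0` for some `y₀ ∈ [−1, 0]` ⇒
  `π²∫₋₁¹u² ≤ ∫₋₁¹u′²`: the HALF-SHIFT DECOMPOSITION `u = E + M`, `u(· + 1) = E − M` on `[−1, 0]` with
  `E = (u + u(·+1))/2` periodic-with-a-zero and `M = (u − u(·+1))/2` antiperiodic, `∫₋₁¹u² = 2∫₋₁⁰(E² + M²)`;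
* `exists_antipodal_zero_of_integral_comp_eq_zero` — for `φ` odd, strictly increasing, continuous and `u`
  continuous: `∫₋₁¹φ(u) = 0 ⇒ ∃ y₀ ∈ [−1, 0], u(y₀) + u(y₀ + 1) = 0` (else `u + u(·+1)` has a sign on `[−1, 0]`
  by the intermediate value theorem, hence so has `φ(u) + φ(u(·+1))`, whose `∫₋₁⁰` is `∫₋₁¹φ(u) = 0`);
* **`sq_integral_le_of_integral_odd_comp_eq_zero`** (+ `_interval`) — the GENERALISED WIRTINGER INEQUALITY WITH AN
  ODD INCREASING CONSTRAINT: `u(−1) = u(1)`, `∫₋₁¹φ(u) = 0 ⇒ π²∫₋₁¹u² ≤ ∫₋₁¹u′²`; on `[a, b]` with `u a = u b`,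
  `∫ₐᵇφ(u) = 0`: `(2π/T)²∫ₐᵇu² ≤ ∫ₐᵇu′²`;
* **`absRpow_constraint_wirtinger_interval`** — the power constraint `∫ₐᵇ|u|^{r−2}u = 0` for EVERY real `r > 1`
  (`φ(t) = |t|^{r−2}t`, `strictMono_abs_rpow_mul_self` / `continuous_abs_rpow_mul_self` for `p = r − 2 > −1`);
  for `2 ≤ r ≤ 3` this is Croce–Dacorogna 2003 Thm 1.1 + Rem. 1.2 (i) at `p = q = 2` [cite: CroceDacorogna2003,
  Thm 1.1] (Literature: `croceDacorognaWirtinger_interval`), whose published proof is variational; the range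
  `r > 1` and the elementary proof are the cell's;
* **`constrainedWirtinger_body (hq : 0 < q)`** — `∀ u u′, C¹, 1-periodic, ∫₀¹(u²)^{1/q−1/2}u = 0 ⇒ 4π²∫₀¹u² ≤
  ∫₀¹u′²`, i.e. the BODY of K40b's `TopEigLaminate.ConstrainedWirtinger q`, for every `q > 0` (`r = 1 + 2/q`).
CONSEQUENCE (drawn in `NoGo/TopEigHeatLaminateUnconditional`, not here): the `x₂`-laminate witness class of the
wanted kill (F2) is heat-coercive at `16π²(q−1)/q` for EVERY real `q > 1`, both cores, with no hypothesis.
PROVENANCE. Proof text: lit seat g34, `GeneralizedWirtingerInequality.v1.lean` 4c243436fac4e16d / problem-side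
draft 508afc50178a6656, lines 341–662, declarations BYTE-IDENTICAL except ONE: the draft's helper
`sq_rpow_eq_abs_rpow_two_mul` (`(x²)^s = |x|^{2s}`, ≡ the landed `TopEigLaminate.sq_rpow_eq_abs_rpow` of
`NoGo/TopEigHeatLaminateDirichlet` — gate dedup) is dropped and its one use inlined. [folklore: Wirtinger inequalities, the
intermediate value theorem; ours = the odd-constraint theorem for every exponent and the Lean text (proof: lit
g34)] search for candidate a priori estimates; no regularity claim.
FILING (prove seat g29, REQUEST #65): declarations byte-identical to the no-go seat's staged `HalfShiftWirtinger.STAGING.lean` 11a0a52e490c0f45; this line is the only addition.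
-/

noncomputable section

open Set Function Filter MeasureTheory Real
open scoped Topology

namespace Summit.NavierStokesRegularity.FunctionalMining

namespace HalfShiftWirtinger

open Literature.Analysis.FluidPDE

/-- **Wirtinger inequality for a periodic function with a zero.** For a `C¹` function `E` with
`E a = E b` (`a < b`, `T = b − a`) vanishing at some point of `[a, b]`:
`(π/T)² ∫_a^b E² ≤ ∫_a^b E′²` (rotate the period to start at the zero: the engine with the pieces
`E` on `[y₀, b]` and `E(· − T)` on `[b, y₀ + T]`, which vanish at both ends). [folklore] -/
theorem periodic_wirtinger_of_zero {E E' : ℝ → ℝ} {a b : ℝ} (hab : a < b)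
    (hE : ∀ x, HasDerivAt E (E' x) x) (hE'c : Continuous E') (hper : E a = E b) {y₀ : ℝ}
    (hy₀ : y₀ ∈ Icc a b) (hz : E y₀ = 0) :
    (π / (b - a)) ^ 2 * ∫ x in a..b, E x ^ 2 ≤ ∫ x in a..b, E' x ^ 2 := by
  have hEc : Continuous E := continuous_iff_continuousAt.mpr fun x => (hE x).continuousAt
  -- the endpoint cases: `E a = E b = 0`, antiperiodic Wirtinger directly
  by_cases hend : y₀ = a ∨ y₀ = b
  · have ha0 : E a = 0 := by
      rcases hend with h | h
      · rw [← h, hz]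
      · rw [hper, ← h, hz]
    have hb0 : E b = 0 := by rw [← hper, ha0]
    exact antiperiodic_wirtinger hab hE hE'c (by rw [hb0, ha0, neg_zero])
  push Not at hend
  have hay : a < y₀ := lt_of_le_of_ne hy₀.1 (Ne.symm hend.1)
  have hyb : y₀ < b := lt_of_le_of_ne hy₀.2 hend.2
  -- the rotated pieces
  have hE2 : ∀ x, HasDerivAt (fun x => E (x - (b - a))) (E' (x - (b - a))) x := fun x =>
    (hE (x - (b - a))).comp_sub_const x (b - a)
  have hE2c : Continuous fun x => E' (x - (b - a)) := hE'c.comp (by fun_prop)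
  have hcb : b < y₀ + (b - a) := by linarith
  have h := antiperiodic_wirtinger_two_piece (M₁ := E) (M₂ := fun x => E (x - (b - a))) hyb hcb
    hE hE'c hE2 hE2c (by show E b = E (b - (b - a)); rw [show b - (b - a) = a by ring, hper])
    (by show E (y₀ + (b - a) - (b - a)) = -E y₀; rw [show y₀ + (b - a) - (b - a) = y₀ by ring, hz,
      neg_zero])
  have hT : y₀ + (b - a) - y₀ = b - a := by ring
  rw [hT] at h
  have e1 : ∫ x in b..y₀ + (b - a), E (x - (b - a)) ^ 2 = ∫ x in a..y₀, E x ^ 2 := by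
    rw [intervalIntegral.integral_comp_sub_right (fun x => E x ^ 2) (b - a)]
    congr 1 <;> ring
  have e2 : ∫ x in b..y₀ + (b - a), E' (x - (b - a)) ^ 2 = ∫ x in a..y₀, E' x ^ 2 := by
    rw [intervalIntegral.integral_comp_sub_right (fun x => E' x ^ 2) (b - a)]
    congr 1 <;> ring
  rw [e1, e2] at h
  have s1 : (∫ x in y₀..b, E x ^ 2) + ∫ x in a..y₀, E x ^ 2 = ∫ x in a..b, E x ^ 2 := by
    rw [add_comm]
    exact intervalIntegral.integral_add_adjacent_intervals ((hEc.pow 2).intervalIntegrable _ _)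
      ((hEc.pow 2).intervalIntegrable _ _)
  have s2 : (∫ x in y₀..b, E' x ^ 2) + ∫ x in a..y₀, E' x ^ 2 = ∫ x in a..b, E' x ^ 2 := by
    rw [add_comm]
    exact intervalIntegral.integral_add_adjacent_intervals ((hE'c.pow 2).intervalIntegrable _ _)
      ((hE'c.pow 2).intervalIntegrable _ _)
  rwa [s1, s2] at h

/-- **Wirtinger's inequality with constant `π²` on `(−1, 1)` under an antipodal zero.** For a `C¹`
function `u` with `u(−1) = u(1)` such that `u(y₀) + u(y₀ + 1) = 0` for some `y₀ ∈ [−1, 0]`: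
`π² ∫_{−1}^{1} u² ≤ ∫_{−1}^{1} u′²`. Proof: the half-shift decomposition
`u = E + M`, `u(· + 1) = E − M` on `[−1, 0]` with `E = (u + u(·+1))/2` (`E(−1) = E(0)`, zero at
`y₀`) and `M = (u − u(·+1))/2` (`M(0) = −M(−1)`); `∫_{−1}^{1} u² = 2∫_{−1}^{0}(E² + M²)` and the
same for `u′`; `periodic_wirtinger_of_zero` for `E` and `antiperiodic_wirtinger` for `M` on
`[−1, 0]` (period `1`, constant `π²`). [folklore] -/
theorem wirtinger_of_antipodal_zero {u u' : ℝ → ℝ} (hu : ∀ y, HasDerivAt u (u' y) y)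
    (hu'c : Continuous u') (hper : u (-1) = u 1) {y₀ : ℝ} (hy₀ : y₀ ∈ Icc (-1 : ℝ) 0)
    (hz : u y₀ + u (y₀ + 1) = 0) :
    π ^ 2 * ∫ y in (-1 : ℝ)..1, u y ^ 2 ≤ ∫ y in (-1 : ℝ)..1, u' y ^ 2 := by
  have huc : Continuous u := continuous_iff_continuousAt.mpr fun x => (hu x).continuousAt
  have hu1 : ∀ y, HasDerivAt (fun y => u (y + 1)) (u' (y + 1)) y := fun y =>
    (hu (y + 1)).comp_add_const y 1
  -- the half-shift decomposition
  have hE : ∀ y, HasDerivAt (fun y => (u y + u (y + 1)) / 2) ((u' y + u' (y + 1)) / 2) y :=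
    fun y => ((hu y).add (hu1 y)).div_const 2
  have hM : ∀ y, HasDerivAt (fun y => (u y - u (y + 1)) / 2) ((u' y - u' (y + 1)) / 2) y :=
    fun y => ((hu y).sub (hu1 y)).div_const 2
  have hE'c : Continuous fun y => (u' y + u' (y + 1)) / 2 := by fun_prop
  have hM'c : Continuous fun y => (u' y - u' (y + 1)) / 2 := by fun_prop
  have h10 : (-1 : ℝ) < 0 := by norm_num
  have e10 : (-1 : ℝ) + 1 = 0 := by norm_num
  have e01 : (0 : ℝ) + 1 = 1 := by norm_num
  have hB := periodic_wirtinger_of_zero h10 hE hE'c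
    (by show (u (-1) + u (-1 + 1)) / 2 = (u 0 + u (0 + 1)) / 2; rw [hper, e10, e01]; ring) hy₀
    (by show (u y₀ + u (y₀ + 1)) / 2 = 0; rw [hz, zero_div])
  have hA := antiperiodic_wirtinger h10 hM hM'c
    (by show (u 0 - u (0 + 1)) / 2 = -((u (-1) - u (-1 + 1)) / 2); rw [hper, e10, e01]; ring)
  have hπ : (π / (0 - (-1)) : ℝ) ^ 2 = π ^ 2 := by norm_num
  rw [hπ] at hA hB
  -- `∫_{-1}^{1} f = ∫_{-1}^{0} (f + f(·+1))` for `f = u², u'²`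
  have split : ∀ f : ℝ → ℝ, Continuous f →
      ∫ y in (-1 : ℝ)..1, f y = ∫ y in (-1 : ℝ)..0, (f y + f (y + 1)) := by
    intro f hf
    have hf1 : Continuous fun y => f (y + 1) := by fun_prop
    rw [intervalIntegral.integral_add (hf.intervalIntegrable _ _) (hf1.intervalIntegrable _ _),
      intervalIntegral.integral_comp_add_right f 1]
    norm_num
    exact (intervalIntegral.integral_add_adjacent_intervals (hf.intervalIntegrable _ _)
      (hf.intervalIntegrable _ _)).symm
  have dec : ∀ p q : ℝ, p ^ 2 + q ^ 2 = 2 * (((p + q) / 2) ^ 2 + ((p - q) / 2) ^ 2) := by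
    intro p q; ring
  have hU : ∫ y in (-1 : ℝ)..1, u y ^ 2 = 2 * ((∫ y in (-1 : ℝ)..0, ((u y + u (y + 1)) / 2) ^ 2) +
      ∫ y in (-1 : ℝ)..0, ((u y - u (y + 1)) / 2) ^ 2) := by
    rw [split (fun y => u y ^ 2) (huc.pow 2), ← intervalIntegral.integral_add
      ((by fun_prop : Continuous fun y => ((u y + u (y + 1)) / 2) ^ 2).intervalIntegrable _ _)
      ((by fun_prop : Continuous fun y => ((u y - u (y + 1)) / 2) ^ 2).intervalIntegrable _ _),
      ← intervalIntegral.integral_const_mul]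
    exact intervalIntegral.integral_congr fun y _ => dec _ _
  have hU' : ∫ y in (-1 : ℝ)..1, u' y ^ 2 =
      2 * ((∫ y in (-1 : ℝ)..0, ((u' y + u' (y + 1)) / 2) ^ 2) +
      ∫ y in (-1 : ℝ)..0, ((u' y - u' (y + 1)) / 2) ^ 2) := by
    rw [split (fun y => u' y ^ 2) (hu'c.pow 2), ← intervalIntegral.integral_add
      ((by fun_prop : Continuous fun y => ((u' y + u' (y + 1)) / 2) ^ 2).intervalIntegrable _ _)
      ((by fun_prop : Continuous fun y => ((u' y - u' (y + 1)) / 2) ^ 2).intervalIntegrable _ _),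
      ← intervalIntegral.integral_const_mul]
    exact intervalIntegral.integral_congr fun y _ => dec _ _
  rw [hU, hU']
  linarith

/-- `t ↦ |t|^p · t` (`= sign(t)|t|^{p+1}`) is strictly increasing for `p > −1`. [folklore] -/
theorem strictMono_abs_rpow_mul_self {p : ℝ} (hp : -1 < p) :
    StrictMono fun t : ℝ => |t| ^ p * t := by
  have hp1 : 0 < p + 1 := by linarith
  have mono_nonneg : ∀ a b : ℝ, 0 ≤ a → a < b → |a| ^ p * a < |b| ^ p * b := by
    intro a b ha hab
    have hb : 0 < b := by linarith
    have eb : |b| ^ p * b = b ^ (p + 1) := by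
      rw [abs_of_pos hb, Real.rpow_add_one hb.ne' p]
    rcases ha.eq_or_lt with h | h
    · rw [← h, mul_zero, eb]; exact Real.rpow_pos_of_pos hb _
    · have ea : |a| ^ p * a = a ^ (p + 1) := by
        rw [abs_of_pos h, Real.rpow_add_one h.ne' p]
      rw [ea, eb]; exact Real.rpow_lt_rpow ha hab hp1
  intro a b hab
  dsimp only
  rcases le_or_gt 0 a with ha | ha
  · exact mono_nonneg a b ha hab
  · rcases le_or_gt b 0 with hb | hb
    · have h := mono_nonneg (-b) (-a) (by linarith) (by linarith)
      rw [abs_neg, abs_neg] at h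
      linarith
    · have h1 : |a| ^ p * a < 0 :=
        mul_neg_of_pos_of_neg (Real.rpow_pos_of_pos (abs_pos.2 ha.ne) _) ha
      have h2 : 0 < |b| ^ p * b := mul_pos (Real.rpow_pos_of_pos (abs_pos.2 hb.ne') _) hb
      linarith

/-- `t ↦ |t|^p · t` is continuous for `p > −1` (at `0`: `‖|t|^p t‖ = |t|^{p+1} → 0`). [folklore] -/
theorem continuous_abs_rpow_mul_self {p : ℝ} (hp : -1 < p) :
    Continuous fun t : ℝ => |t| ^ p * t := by
  have hp1 : 0 < p + 1 := by linarith
  have hg : Continuous fun t : ℝ => |t| ^ (p + 1) :=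
    continuous_abs.rpow_const fun _ => Or.inr hp1.le
  have hbound : ∀ t : ℝ, ‖|t| ^ p * t‖ ≤ |t| ^ (p + 1) := by
    intro t
    by_cases ht : t = 0
    · rw [ht, mul_zero, norm_zero]; exact Real.rpow_nonneg (abs_nonneg _) _
    · rw [Real.norm_eq_abs, abs_mul, abs_of_nonneg (Real.rpow_nonneg (abs_nonneg t) p),
        Real.rpow_add_one (abs_ne_zero.2 ht)]
  refine continuous_iff_continuousAt.2 fun t => ?_
  by_cases ht : t = 0
  · subst ht
    rw [ContinuousAt, mul_zero]
    refine squeeze_zero_norm hbound ?_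
    have := hg.tendsto 0
    rwa [abs_zero, Real.zero_rpow hp1.ne'] at this
  · exact (continuous_abs.continuousAt.rpow_const (Or.inl (abs_ne_zero.2 ht))).mul
      continuousAt_id

/-- **The constraint forces an antipodal zero.** If `φ` is odd, strictly increasing and
continuous, `u` is continuous and `∫_{−1}^{1} φ(u) = 0`, then `u(y₀) + u(y₀ + 1) = 0` for some
`y₀ ∈ [−1, 0]`: otherwise `u + u(·+1)` has a sign on `[−1, 0]`, hence so has
`φ(u) + φ(u(·+1))` pointwise (`φ` odd increasing), contradicting
`∫_{−1}^{0} [φ(u) + φ(u(·+1))] = ∫_{−1}^{1} φ(u) = 0`. [folklore] -/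
theorem exists_antipodal_zero_of_integral_comp_eq_zero (φ : ℝ → ℝ) (hφo : ∀ t, φ (-t) = -φ t)
    (hφm : StrictMono φ) (hφc : Continuous φ) {u : ℝ → ℝ} (huc : Continuous u)
    (h0 : ∫ y in (-1 : ℝ)..1, φ (u y) = 0) :
    ∃ y₀ ∈ Icc (-1 : ℝ) 0, u y₀ + u (y₀ + 1) = 0 := by
  -- the positive case, for a general continuous `v` with `∫ φ(v) = 0`
  have pos_case : ∀ v : ℝ → ℝ, Continuous v → (∫ y in (-1 : ℝ)..1, φ (v y)) = 0 →
      (∀ y ∈ Icc (-1 : ℝ) 0, 0 < v y + v (y + 1)) → False := by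
    intro v hvc hv0 hpos
    have hφv : Continuous fun y => φ (v y) := hφc.comp hvc
    have hφv1 : Continuous fun y => φ (v (y + 1)) := by fun_prop
    have hsplit : ∫ y in (-1 : ℝ)..1, φ (v y) = ∫ y in (-1 : ℝ)..0, (φ (v y) + φ (v (y + 1))) := by
      rw [intervalIntegral.integral_add (hφv.intervalIntegrable _ _) (hφv1.intervalIntegrable _ _),
        intervalIntegral.integral_comp_add_right (fun y => φ (v y)) 1]
      norm_num
      exact (intervalIntegral.integral_add_adjacent_intervals (hφv.intervalIntegrable _ _)
        (hφv.intervalIntegrable _ _)).symm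
    have hlt : 0 < ∫ y in (-1 : ℝ)..0, (φ (v y) + φ (v (y + 1))) := by
      refine intervalIntegral.intervalIntegral_pos_of_pos_on
        ((hφv.add hφv1).intervalIntegrable _ _) ?_ (by norm_num)
      intro y hy
      have h1 : -v (y + 1) < v y := by linarith [hpos y (Ioo_subset_Icc_self hy)]
      have h2 := hφm h1
      rw [hφo] at h2
      linarith
    rw [← hsplit, hv0] at hlt
    exact lt_irrefl _ hlt
  by_contra H
  push Not at H
  -- `S = u + u(·+1)` has no zero on `[-1, 0]`, hence a sign (intermediate value theorem)
  have hSc : Continuous fun y => u y + u (y + 1) := by fun_prop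
  rcases lt_or_gt_of_ne (H (-1) (by norm_num)) with hneg | hpos
  · -- negative at `-1` ⇒ negative everywhere ⇒ apply the positive case to `-u`
    refine pos_case (fun y => -u y) huc.neg
      (by simp only [hφo, intervalIntegral.integral_neg, h0, neg_zero]) ?_
    intro y hy
    rcases lt_or_gt_of_ne (H y hy) with h | h
    · linarith
    · exfalso
      have hivt := intermediate_value_Icc (f := fun y => u y + u (y + 1)) hy.1 hSc.continuousOn
      have h0mem : (0 : ℝ) ∈ Icc (u (-1) + u (-1 + 1)) (u y + u (y + 1)) := ⟨hneg.le, h.le⟩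
      obtain ⟨z, hz, hz0⟩ := hivt h0mem
      exact H z ⟨hz.1, hz.2.trans hy.2⟩ hz0
  · refine pos_case u huc h0 ?_
    intro y hy
    rcases lt_or_gt_of_ne (H y hy) with h | h
    · exfalso
      have hivt := intermediate_value_Icc' (f := fun y => u y + u (y + 1)) hy.1 hSc.continuousOn
      have h0mem : (0 : ℝ) ∈ Icc (u y + u (y + 1)) (u (-1) + u (-1 + 1)) := ⟨h.le, hpos.le⟩
      obtain ⟨z, hz, hz0⟩ := hivt h0mem
      exact H z ⟨hz.1, hz.2.trans hy.2⟩ hz0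
    · exact h

/-- **Generalized Wirtinger inequality with an odd increasing constraint** (`p = q = 2`). For
`φ` odd, strictly increasing and continuous, and a `C¹` function `u` with `u(−1) = u(1)` and
`∫_{−1}^{1} φ(u) = 0`: `π² ∫_{−1}^{1} u² ≤ ∫_{−1}^{1} u′²` (equality for `u = A cos(πy + c)`).
This is `exists_antipodal_zero_of_integral_comp_eq_zero` + `wirtinger_of_antipodal_zero`; it
contains Croce–Dacorogna 2003 Thm 1.1 at `p = q = 2` (`φ(t) = |t|^{r−2}t`) — by a different,
elementary proof (the published proof is variational: existence of minimizers and an analysis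
of the Euler–Lagrange equation). [ours; proof: lit g34] -/
theorem sq_integral_le_of_integral_odd_comp_eq_zero (φ : ℝ → ℝ) (hφo : ∀ t, φ (-t) = -φ t)
    (hφm : StrictMono φ) (hφc : Continuous φ) {u u' : ℝ → ℝ} (hu : ∀ y, HasDerivAt u (u' y) y)
    (hu'c : Continuous u') (hper : u (-1) = u 1) (h0 : ∫ y in (-1 : ℝ)..1, φ (u y) = 0) :
    π ^ 2 * ∫ y in (-1 : ℝ)..1, u y ^ 2 ≤ ∫ y in (-1 : ℝ)..1, u' y ^ 2 := by
  have huc : Continuous u := continuous_iff_continuousAt.mpr fun x => (hu x).continuousAt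
  obtain ⟨y₀, hy₀, hz⟩ := exists_antipodal_zero_of_integral_comp_eq_zero φ hφo hφm hφc huc h0
  exact wirtinger_of_antipodal_zero hu hu'c hper hy₀ hz

/-- **Rescaled form on an interval** (`p = q = 2`): for `a < b`, `φ` odd, strictly increasing
and continuous, and a `C¹` function `u` with `u a = u b` and `∫_a^b φ(u) = 0`:
`(2π/(b−a))² ∫_a^b u² ≤ ∫_a^b u′²` (the affine change of variables `x = (a+b)/2 + (b−a)/2·y`;
Croce–Dacorogna Rem. 1.2 (i): `α_{a,b}(2,2,r) = (2/(b−a))·π`). [ours; proof: lit g34] -/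
theorem sq_integral_le_of_integral_odd_comp_eq_zero_interval (φ : ℝ → ℝ)
    (hφo : ∀ t, φ (-t) = -φ t) (hφm : StrictMono φ) (hφc : Continuous φ) {u u' : ℝ → ℝ}
    {a b : ℝ} (hab : a < b) (hu : ∀ x, HasDerivAt u (u' x) x) (hu'c : Continuous u')
    (hper : u a = u b) (h0 : ∫ x in a..b, φ (u x) = 0) :
    (2 * π / (b - a)) ^ 2 * ∫ x in a..b, u x ^ 2 ≤ ∫ x in a..b, u' x ^ 2 := by
  set h : ℝ := (b - a) / 2 with hh
  set m : ℝ := (a + b) / 2 with hm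
  have hpos : 0 < h := by rw [hh]; linarith
  have hne : h ≠ 0 := hpos.ne'
  have hlo : h * (-1) + m = a := by rw [hh, hm]; ring
  have hhi : h * 1 + m = b := by rw [hh, hm]; ring
  -- the rescaled function `v(y) = u(h y + m)`
  have hin : ∀ y : ℝ, HasDerivAt (fun y : ℝ => h * y + m) h y := fun y => by
    simpa using ((hasDerivAt_id y).const_mul h).add_const m
  have hv : ∀ y, HasDerivAt (fun y => u (h * y + m)) (h * u' (h * y + m)) y := fun y =>
    ((hu (h * y + m)).comp y (hin y)).congr_deriv (by ring)
  have hv'c : Continuous fun y => h * u' (h * y + m) := by fun_prop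
  have hvper : (fun y => u (h * y + m)) (-1) = (fun y => u (h * y + m)) 1 := by
    show u (h * (-1) + m) = u (h * 1 + m); rw [hlo, hhi, hper]
  have resc : ∀ f : ℝ → ℝ, ∫ y in (-1 : ℝ)..1, f (h * y + m) = h⁻¹ * ∫ x in a..b, f x := by
    intro f
    rw [intervalIntegral.integral_comp_mul_add f hne m, hlo, hhi, smul_eq_mul]
  have hv0 : ∫ y in (-1 : ℝ)..1, φ (u (h * y + m)) = 0 := by
    rw [resc (fun x => φ (u x)), h0, mul_zero]
  have key := sq_integral_le_of_integral_odd_comp_eq_zero φ hφo hφm hφc hv hv'c hvper hv0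
  rw [resc (fun x => u x ^ 2)] at key
  have e2 : ∫ y in (-1 : ℝ)..1, (h * u' (h * y + m)) ^ 2 =
      h⁻¹ * (h ^ 2 * ∫ x in a..b, u' x ^ 2) := by
    rw [← intervalIntegral.integral_const_mul, ← resc (fun x => h ^ 2 * u' x ^ 2)]
    exact intervalIntegral.integral_congr fun y _ => by ring
  rw [e2] at key
  -- `key : π² (h⁻¹ A) ≤ h⁻¹ (h² B)`; conclude `(π/h)² A ≤ B`
  have eπ : (2 * π / (b - a)) = π / h := by rw [hh]; field_simp
  rw [eπ]
  have := mul_le_mul_of_nonneg_left key hpos.le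
  have k2 : π ^ 2 * (∫ x in a..b, u x ^ 2) ≤ h ^ 2 * ∫ x in a..b, u' x ^ 2 := by
    have e1 : h * (π ^ 2 * (h⁻¹ * ∫ x in a..b, u x ^ 2)) = π ^ 2 * ∫ x in a..b, u x ^ 2 := by
      field_simp
    have e3 : h * (h⁻¹ * (h ^ 2 * ∫ x in a..b, u' x ^ 2)) = h ^ 2 * ∫ x in a..b, u' x ^ 2 := by
      field_simp
    rwa [e1, e3] at this
  have h2 : 0 < h ^ 2 := by positivity
  calc (π / h) ^ 2 * ∫ x in a..b, u x ^ 2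
      = (π ^ 2 * ∫ x in a..b, u x ^ 2) / h ^ 2 := by rw [div_pow]; ring
    _ ≤ (h ^ 2 * ∫ x in a..b, u' x ^ 2) / h ^ 2 := div_le_div_of_nonneg_right k2 h2.le
    _ = _ := by field_simp

/-- **Power-constraint Wirtinger inequality on an interval, every exponent `r > 1`**: for `a < b`
and a `C¹` function `u` with `u a = u b` and `∫_a^b |u|^{r−2}u = 0`:
`(2π/(b−a))² ∫_a^b u² ≤ ∫_a^b u′²`. For `2 ≤ r ≤ 3` this is Croce–Dacorogna 2003 Thm 1.1 +
Rem. 1.2 (i) at `p = q = 2` (Literature: `croceDacorognaWirtinger_interval`); the full range `r > 1`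
is the cell's own theorem (half-shift proof). [ours; proof: lit g34, GeneralizedWirtingerInequality
v1 4c243436fac4e16d] -/
theorem absRpow_constraint_wirtinger_interval {r : ℝ} (hr : 1 < r) {u u' : ℝ → ℝ} {a b : ℝ}
    (hab : a < b) (hu : ∀ x, HasDerivAt u (u' x) x) (hu'c : Continuous u') (hper : u a = u b)
    (h0 : ∫ x in a..b, |u x| ^ (r - 2) * u x = 0) :
    (2 * π / (b - a)) ^ 2 * ∫ x in a..b, u x ^ 2 ≤ ∫ x in a..b, u' x ^ 2 := by
  have hp : -1 < r - 2 := by linarith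
  exact sq_integral_le_of_integral_odd_comp_eq_zero_interval (fun t => |t| ^ (r - 2) * t)
    (fun t => by simp only [abs_neg]; ring) (strictMono_abs_rpow_mul_self hp)
    (continuous_abs_rpow_mul_self hp) hab hu hu'c hper h0


/-- **The body of K40b's `ConstrainedWirtinger q`, for every `q > 0`:** for a `C¹` `1`-periodic `u`
with `∫₀¹ (u²)^{1/q−1/2} u = 0`: `4π² ∫₀¹ u² ≤ ∫₀¹ u′²` (`(u²)^{1/q−1/2}u = |u|^{r−2}u` with
`r = 1 + 2/q > 1`; `absRpow_constraint_wirtinger_interval` on `(0,1)`). A K40b sequel proves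
`ConstrainedWirtinger q` for `0 < q` by `exact constrainedWirtinger_body hq`.
[ours; proof: lit g34] -/
theorem constrainedWirtinger_body {q : ℝ} (hq : 0 < q) :
    ∀ (u u' : ℝ → ℝ), (∀ x, HasDerivAt u (u' x) x) → Continuous u' → Function.Periodic u 1 →
      ∫ x in (0 : ℝ)..1, (u x ^ 2) ^ (1 / q - 1 / 2) * u x = 0 →
        4 * π ^ 2 * ∫ x in (0 : ℝ)..1, u x ^ 2 ≤ ∫ x in (0 : ℝ)..1, u' x ^ 2 := by
  intro u u' hd hc hper h0
  have hr : (1 : ℝ) < 2 * (1 / q - 1 / 2) + 2 := by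
    have : 0 < 1 / q := by positivity
    linarith
  have h0' : ∫ x in (0 : ℝ)..1, |u x| ^ (2 * (1 / q - 1 / 2) + 2 - 2) * u x = 0 := by
    have e : (fun x => |u x| ^ (2 * (1 / q - 1 / 2) + 2 - 2) * u x) =
        fun x => (u x ^ 2) ^ (1 / q - 1 / 2) * u x := by
      funext x; rw [add_sub_cancel_right, Real.rpow_mul (abs_nonneg (u x)), Real.rpow_two, sq_abs]
    rw [e]; exact h0
  have h := absRpow_constraint_wirtinger_interval hr zero_lt_one hd hc (hper 0 ▸ by norm_num) h0'
  norm_num at h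
  linarith [h]

end HalfShiftWirtinger

end Summit.NavierStokesRegularity.FunctionalMining

end
-- search for candidate a priori estimates; no regularity claim
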